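/-
Copyright (c) 2026 The HCML crux team. All rights reserved.
Released under Apache 2.0 license as described in the file LICENSE.
Authors: K2E3-p14 (g5) (explicit-unit `hodgecm-mathlib-K2E3-p14-g5`)
-/
import Summits.HodgeConjecture.HodgeConjecture.Theorems.K2E3GL3MixedTorusNormForm     -- (T18-mixed file 1) this seat: projector, torus element, norm form, anisotropy
import Summits.HodgeConjecture.HodgeConjecture.Theorems.K2E3GL3FinConjBoxes          -- ★ (K2E3-p23): `v_det_le_of_entries_le`
import Mathlib.Tactic.ComputeDegree
import HarnessLib

/-!
# (GL-[M6]-sc, T18-mixed, file 2 of 2) Harish-Chandra's Theorem 18 at the mixed torus `E^× × F^×` of `GL₃`, with explicit exponent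

Cell `hodgecm-mathlib`, Track B, line `K2_E3_EllipticInputs`; payer «GL-[M6]-sc» of leaf (11-3-split-sc-NE) (dealer K2E3-plan (g3) D63, line lead K2E3-p23
(g5), RULINGS #13 (M13-1), BLUEPRINT v4 §2 route (i)).  For the companion normal form `γ = !![0, −N, 0; 1, T, 0; 0, 0, c]` of a MIXED regular element
(`π = X² − TX + N` without a root in `F`, centraliser `Z(γ) = F[C_π]^× × F^× ≅ E^× × F^×`) and a conjugate `y = x γ x⁻¹` with INTEGRAL entries:
  **if `|ϖ^L| ≤ |D(γ)|`, `D(γ) = (T² − 4N)·π(c)²` the discriminant of `γ`, then `x · t ∈ 𝔅_L` for some `t ∈ Z(γ)`**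
(`exists_adBall_mul_centralizer_of_conj_integral_mixed`) — Harish-Chandra's Theorem 18 + Corollary [HarishChandra1970, Part VII §2 p. 69] at `T_E`, with the
exponent `|D(γ)|^{−1∕2}` on the nose and no field extension: writing `x = [X₁ | w]`, `x⁻¹ = [Z₁ ; z]`,
(A) the projector `π(γ) = π(c)E₂₂` gives `|π(c)|·|w_i z_l| ≤ 1` (file 1); (B) the row `r₀` of `X₁` of largest `|Q|` (`Q` the norm form `det[r ; rC_π]`) is sent
to `(0,1)` by `P = (−b₀ + a₀C_π)∕Q(r₀) ∈ F[C_π]^×` (Cramer), after which every row of `X₁P` has `|Q| ≤ 1`, hence entries with `|·|² ≤ |T² − 4N|⁻¹` by the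
ANISOTROPY bound (file 1, Hensel); (C) for `W = (x t)⁻¹`, `t = diag(P, 1)`: row `i₀` of `(xt)W = 1` gives `|π(c) W_{1l}| ≤ 1`, and the equivariance
`W y = γ W` gives `W_{0l} = Σ_j W_{1j} y_{jl} − T W_{1l}`, so `|π(c) W_{kl}| ≤ 1` for all `k, l`; (D) the third column of `x` is first normalised to have top entry
`1` (a scalar, invisible to `𝔅`).  Every product `(xt)_{ij}·W_{kl}` then has `|·|² ≤ |T²−4N|⁻¹|π(c)|⁻² = |D(γ)|⁻¹`.
* `exists_adBall_mul_centralizer_of_conj_integral_mixed_of_col` — the estimate for `x` with normalised third column;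
* **`exists_adBall_mul_centralizer_of_conj_integral_mixed`** — the estimate (normalising scalar absorbed by ★ `adBall_mul_scalar_iff`).
CAVEAT (for the assembly): the companion normal form is not scale-invariant, so the hypothesis is «`y` integral» for a scaled lift, not `𝔅_s(y)`.

HONEST LABEL: HC_CM is proved only modulo the 7 printed citations (2 remaining named inputs: hLiu418 = stmt-HodgeConjecture-24832, h413 =
stmt-HodgeConjecture-24833) until rung 0 closes; count-neutral (kernel lane `--supports stmt-HodgeConjecture-24833 --as helper`), THEOREMS ONLY — no `def`, no
instance, no notation, no `sorry`.

## References
* [HarishChandra1970] Harish-Chandra (notes by G. van Dijk), *Harmonic Analysis on Reductive p-adic Groups*, LNM 162 (1970), Part VII §2 Thm 18 + Cor p. 69, §3 Lemma 46,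
  Thm 19 p. 73.
* [NeukirchANT1999] J. Neukirch, *Algebraic Number Theory* (1999), Ch. II §4 (Hensel), §5.
-/

set_option linter.dupNamespace false

noncomputable section

open Set Function
open scoped MatrixGroups WithZero
open Matrix
open Literature.NumberTheory.Automorphic Literature.NumberTheory.GaloisRepresentations Literature.NumberTheory.GaloisRepresentations.IsNonarchimedeanLocalField
open Summit.HodgeConjecture.HodgeConjecture.Cruxes.H413.K2E3GLnAdHeightBalls Summit.HodgeConjecture.HodgeConjecture.Cruxes.H413.K2E3GL3TruncatedCharSplitTorusRadius
open Summit.HodgeConjecture.HodgeConjecture.Cruxes.H413.K2E3GL3MixedTorusNormForm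

namespace Summit.HodgeConjecture.HodgeConjecture.Cruxes.H413.K2E3GL3TruncatedCharMixedTorusRadius

variable {F : Type*} [Field F] [Valued F ℤᵐ⁰] [ValuativeRel F] [(Valued.v : Valuation F ℤᵐ⁰).Compatible] [IsNonarchimedeanLocalField F]

omit [ValuativeRel F] [(Valued.v : Valuation F ℤᵐ⁰).Compatible] [IsNonarchimedeanLocalField F] in
/-- `|T² − 4N| ≤ 1` for integral `T, N`. [folklore] -/
theorem v_discr_le_one {T N : F} (hT : Valued.v T ≤ 1) (hN : Valued.v N ≤ 1) : Valued.v (T ^ 2 - 4 * N) ≤ 1 := by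
  have h4 : Valued.v (4 : F) ≤ 1 := by
    have h4eq : (4 : F) = 1 + 1 + 1 + 1 := by norm_num
    rw [h4eq]
    exact Valuation.map_add_le _ (Valuation.map_add_le _ (Valuation.map_add_le _ (map_one Valued.v).le (map_one Valued.v).le) (map_one Valued.v).le)
      (map_one Valued.v).le
  refine (Valuation.map_sub _ _ _).trans (max_le ?_ ?_)
  · rw [map_pow]; exact pow_le_one' hT _
  · rw [map_mul]; exact mul_le_one' h4 hN

omit [ValuativeRel F] [(Valued.v : Valuation F ℤᵐ⁰).Compatible] [IsNonarchimedeanLocalField F] in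
/-- From `(v a)² · d ≤ 1`, `v(p b) ≤ 1` and `v(q) ≤ d · (v p)²`, `v q ≤ 1`: `v(q · (a b)) ≤ 1` (the squaring step of the final estimate). [folklore] -/
theorem v_mul_mul_le_one_of_sq {a b p q : F} {d : ℤᵐ⁰} (ha : d * Valued.v a ^ 2 ≤ 1) (hb : Valued.v (p * b) ≤ 1) (hq : Valued.v q ≤ d * Valued.v p ^ 2)
    (hq1 : Valued.v q ≤ 1) : Valued.v (q * (a * b)) ≤ 1 := by
  rw [← pow_le_one_iff two_ne_zero, map_mul, map_mul, mul_pow, mul_pow]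
  rw [map_mul] at hb
  have hb2 : (Valued.v p * Valued.v b) ^ 2 ≤ 1 := pow_le_one' hb _
  calc Valued.v q ^ 2 * (Valued.v a ^ 2 * Valued.v b ^ 2) = Valued.v q * (Valued.v q * (Valued.v a ^ 2 * Valued.v b ^ 2)) := by rw [sq, mul_assoc]
    _ ≤ 1 * ((d * Valued.v p ^ 2) * (Valued.v a ^ 2 * Valued.v b ^ 2)) := mul_le_mul' hq1 (mul_le_mul_left hq _)
    _ = (d * Valued.v a ^ 2) * (Valued.v p * Valued.v b) ^ 2 := by rw [one_mul, mul_pow, mul_mul_mul_comm]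
    _ ≤ 1 * 1 := mul_le_mul' ha hb2
    _ = 1 := one_mul _

/-- **THEOREM 18 AT THE MIXED TORUS, third column normalised**: as `exists_adBall_mul_centralizer_of_conj_integral_mixed`, for `x` whose third column has entries
of valuation `≤ 1` with the entry `x_{i₁ 2} = 1`. [cite: HarishChandra1970, Part VII §2 Theorem 18 p. 69; §3 Lemma 46 p. 73] -/
theorem exists_adBall_mul_centralizer_of_conj_integral_mixed_of_col {ϖ : F} (hϖ0 : ϖ ≠ 0) {x γ : GL (Fin 3) F} {T N c : F}
    (hγ : (γ : Matrix (Fin 3) (Fin 3) F) = !![0, -N, 0; 1, T, 0; 0, 0, c]) (hπ : ∀ r : F, r ^ 2 - T * r + N ≠ 0)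
    (hy : ∀ i j, Valued.v ((((x * γ * x⁻¹ : GL (Fin 3) F)) : Matrix (Fin 3) (Fin 3) F) i j) ≤ 1)
    {i₁ : Fin 3} (hw1 : (x : Matrix (Fin 3) (Fin 3) F) i₁ 2 = 1) (hw : ∀ i, Valued.v ((x : Matrix (Fin 3) (Fin 3) F) i 2) ≤ 1) {L : ℕ}
    (hD : Valued.v (ϖ ^ L) ≤ Valued.v ((T ^ 2 - 4 * N) * (c ^ 2 - T * c + N) ^ 2)) :
    ∃ t : GL (Fin 3) F, t * γ = γ * t ∧
      ∀ i j k l, Valued.v (ϖ ^ L * (((x * t : GL (Fin 3) F) : Matrix (Fin 3) (Fin 3) F) i j * (((x * t)⁻¹ : GL (Fin 3) F) : Matrix (Fin 3) (Fin 3) F) k l)) ≤ 1 := by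
  set X : Matrix (Fin 3) (Fin 3) F := (x : Matrix (Fin 3) (Fin 3) F) with hX
  set X' : Matrix (Fin 3) (Fin 3) F := ((x⁻¹ : GL (Fin 3) F) : Matrix (Fin 3) (Fin 3) F) with hX'
  set Y : Matrix (Fin 3) (Fin 3) F := ((x * γ * x⁻¹ : GL (Fin 3) F) : Matrix (Fin 3) (Fin 3) F) with hY
  set D : F := T ^ 2 - 4 * N with hDdef
  set pc : F := c ^ 2 - T * c + N with hpc
  -- §0 integrality facts (file 1)
  have hT : Valued.v T ≤ 1 := v_T_le_one hγ hy
  have hN : Valued.v N ≤ 1 := v_N_le_one hγ hy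
  have hc : Valued.v c ≤ 1 := v_c_le_one hγ hy
  have hD1 : Valued.v D ≤ 1 := v_discr_le_one hT hN
  have hpc1 : Valued.v pc ≤ 1 := by
    refine Valuation.map_add_le _ ((Valuation.map_sub _ _ _).trans (max_le ?_ ?_)) hN
    · rw [map_pow]; exact pow_le_one' hc _
    · rw [map_mul]; exact mul_le_one' hT hc
  have hDpc0 : Valued.v (D * pc ^ 2) ≠ 0 := by
    intro h0
    rw [h0, le_zero_iff, map_pow, pow_eq_zero_iff', Valuation.zero_iff] at hD
    exact hϖ0 hD.1
  have hD0 : D ≠ 0 := fun h => hDpc0 (by rw [h, zero_mul, map_zero])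
  have hpc0 : pc ≠ 0 := fun h => hDpc0 (by rw [h, zero_pow two_ne_zero, mul_zero, map_zero])
  have hA : ∀ i l, Valued.v (pc * (X i 2 * X' 2 l)) ≤ 1 := fun i l => v_evalc_mul_apply_mul_inv_apply_le_one hγ hy i l
  -- §1 the row of largest norm form and Cramer's element
  obtain ⟨i₀, -, hi₀⟩ := Finset.exists_max_image (Finset.univ : Finset (Fin 3))
    (fun i => Valued.v (X i 0 * (X i 1 * T - X i 0 * N) - X i 1 * X i 1)) Finset.univ_nonempty
  have han : ∀ i, Valued.v (D * X i 0 ^ 2) ≤ Valued.v (X i 0 * (X i 1 * T - X i 0 * N) - X i 1 * X i 1) ∧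
      Valued.v (D * X i 1 ^ 2) ≤ Valued.v (X i 0 * (X i 1 * T - X i 0 * N) - X i 1 * X i 1) := fun i =>
    v_discr_mul_sq_le_v_normForm hπ hT hN (X i 0) (X i 1)
  have hQ0 : X i₀ 0 * (X i₀ 1 * T - X i₀ 0 * N) - X i₀ 1 * X i₀ 1 ≠ 0 := by
    intro h0
    -- all `Q i = 0`, hence the first column of `x` vanishes
    obtain ⟨i, hi⟩ := exists_apply_ne_zero_of_col x 0
    have h1 : Valued.v (X i 0 * (X i 1 * T - X i 0 * N) - X i 1 * X i 1) = 0 :=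
      le_zero_iff.1 ((hi₀ i (Finset.mem_univ _)).trans_eq (by rw [h0, map_zero]))
    have h2 := (han i).1
    rw [h1, le_zero_iff, map_mul, mul_eq_zero, map_pow, pow_eq_zero_iff two_ne_zero, Valuation.zero_iff, Valuation.zero_iff] at h2
    rcases h2 with h2 | h2
    · exact hD0 h2
    · exact hi h2
  obtain ⟨u, hu⟩ : ∃ u : F, u = -X i₀ 1 / (X i₀ 0 * (X i₀ 1 * T - X i₀ 0 * N) - X i₀ 1 * X i₀ 1) := ⟨_, rfl⟩
  obtain ⟨v, hv⟩ : ∃ v : F, v = X i₀ 0 / (X i₀ 0 * (X i₀ 1 * T - X i₀ 0 * N) - X i₀ 1 * X i₀ 1) := ⟨_, rfl⟩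
  obtain ⟨hcr0, hcr1, hd⟩ := rowAct_cramer (T := T) (N := N) (a := X i₀ 0) (b := X i₀ 1) hQ0
  rw [← hu, ← hv] at hcr0 hcr1 hd
  set Tm : Matrix (Fin 3) (Fin 3) F := !![u, -(v * N), 0; v, u + v * T, 0; 0, 0, 1] with hTm
  have hdet : Tm.det ≠ 0 := by
    rw [hTm, det_blockT, hd]
    exact neg_ne_zero.2 (inv_ne_zero hQ0)
  set t : GL (Fin 3) F := Matrix.GeneralLinearGroup.mkOfDetNeZero Tm hdet with htdef
  have ht : ((t : GL (Fin 3) F) : Matrix (Fin 3) (Fin 3) F) = Tm := rfl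
  -- `t ∈ Z(γ)`
  have htγ : t * γ = γ * t := by
    refine Units.ext ?_
    rw [Units.val_mul, Units.val_mul, ht, hγ, hTm]
    exact blockT_mul_eq_mul_blockT T N c u v
  refine ⟨t, htγ, ?_⟩
  -- §2 the matrices `g = x t` and `W = (x t)⁻¹`
  set g : Matrix (Fin 3) (Fin 3) F := ((x * t : GL (Fin 3) F) : Matrix (Fin 3) (Fin 3) F) with hg
  set W : Matrix (Fin 3) (Fin 3) F := (((x * t)⁻¹ : GL (Fin 3) F) : Matrix (Fin 3) (Fin 3) F) with hW
  have hgX : g = X * Tm := by rw [hg, Units.val_mul, ht]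
  have hg0 : ∀ i, g i 0 = X i 0 * u + X i 1 * v := fun i => by rw [hgX]; exact (mul_blockT_apply X T N u v i).1
  have hg1 : ∀ i, g i 1 = X i 1 * u + v * (X i 1 * T - X i 0 * N) := fun i => by rw [hgX]; exact (mul_blockT_apply X T N u v i).2.1
  have hg2 : ∀ i, g i 2 = X i 2 := fun i => by rw [hgX]; exact (mul_blockT_apply X T N u v i).2.2
  -- the third row of `t⁻¹` is `e₂`, so the third row of `W` is the third row of `x⁻¹`
  set P : Matrix (Fin 3) (Fin 3) F := (((t⁻¹ : GL (Fin 3) F)) : Matrix (Fin 3) (Fin 3) F) with hPdef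
  have hP : P * Tm = 1 := by rw [hPdef, ← ht, ← Units.val_mul, inv_mul_cancel, Units.val_one]
  have e20 := congrFun (congrFun hP 2) 0
  have e21 := congrFun (congrFun hP 2) 1
  have e22 := congrFun (congrFun hP 2) 2
  rw [Matrix.mul_apply, Fin.sum_univ_three, hTm] at e20 e21 e22
  simp at e20 e21 e22
  have hP20 : P 2 0 = 0 := by
    have h1 : P 2 0 * (u ^ 2 + u * v * T + v ^ 2 * N) = 0 := by
      linear_combination (u + v * T) * e20 - v * e21
    rw [hd] at h1
    exact (mul_eq_zero.1 h1).resolve_right (neg_ne_zero.2 (inv_ne_zero hQ0))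
  have hP21 : P 2 1 = 0 := by
    have h1 : P 2 1 * (u ^ 2 + u * v * T + v ^ 2 * N) = 0 := by
      linear_combination u * e21 + v * N * e20
    rw [hd] at h1
    exact (mul_eq_zero.1 h1).resolve_right (neg_ne_zero.2 (inv_ne_zero hQ0))
  have hWP : W = P * X' := by rw [hW, hPdef, hX', _root_.mul_inv_rev, Units.val_mul]
  have hW2 : ∀ l, W 2 l = X' 2 l := by
    intro l
    rw [hWP, Matrix.mul_apply, Fin.sum_univ_three, hP20, hP21, e22, zero_mul, zero_mul, one_mul, zero_add, zero_add]
  -- row `i₀` of `g W = 1`: `W 1 l = δ − X i₀ 2 · X' 2 l`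
  have hgW : g * W = 1 := by rw [hg, hW, ← Units.val_mul, mul_inv_cancel, Units.val_one]
  have hW1 : ∀ l, W 1 l = (1 : Matrix (Fin 3) (Fin 3) F) i₀ l - X i₀ 2 * X' 2 l := by
    intro l
    have e := congrFun (congrFun hgW i₀) l
    rw [Matrix.mul_apply, Fin.sum_univ_three, hg0, hg1, hg2, hW2, hcr0, hcr1, zero_mul, one_mul, zero_add] at e
    rw [← e, add_sub_cancel_right]
  have hW1b : ∀ l, Valued.v (pc * W 1 l) ≤ 1 := by
    intro l
    rw [hW1, mul_sub]
    refine (Valuation.map_sub _ _ _).trans (max_le ?_ (hA i₀ l))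
    rw [map_mul]
    refine mul_le_one' hpc1 ?_
    by_cases h : i₀ = l
    · subst h; rw [Matrix.one_apply_eq, map_one]
    · rw [Matrix.one_apply_ne h, map_zero]; exact zero_le
  -- equivariance `W Y = γ W`: `W 0 l = Σ_j W 1 j Y j l − T W 1 l`
  have hWY : W * Y = (γ : Matrix (Fin 3) (Fin 3) F) * W := by
    rw [hW, hY, ← Units.val_mul, ← Units.val_mul]
    congr 1
    rw [_root_.mul_inv_rev, mul_assoc, ← mul_assoc x⁻¹, ← mul_assoc x⁻¹, inv_mul_cancel, one_mul]
    have htinv : t⁻¹ * γ = γ * t⁻¹ := by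
      rw [inv_mul_eq_iff_eq_mul, ← mul_assoc, htγ, mul_assoc, mul_inv_cancel, mul_one]
    rw [← mul_assoc, htinv, mul_assoc]
  have hW0 : ∀ l, W 0 l = (∑ j, W 1 j * Y j l) - T * W 1 l := by
    intro l
    have e := congrFun (congrFun hWY 1) l
    rw [Matrix.mul_apply, hγ, (gamma_mul_apply W T N c l).2] at e
    rw [e, add_sub_cancel_right]
  have hW0b : ∀ l, Valued.v (pc * W 0 l) ≤ 1 := by
    intro l
    rw [hW0, mul_sub, Finset.mul_sum]
    refine (Valuation.map_sub _ _ _).trans (max_le (Valuation.map_sum_le _ fun j _ => ?_) ?_)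
    · rw [← mul_assoc, map_mul]; exact mul_le_one' (hW1b j) (hy j l)
    · rw [mul_left_comm, map_mul]; exact mul_le_one' hT (hW1b l)
  have hWb : ∀ k l, Valued.v (pc * W k l) ≤ 1 := by
    intro k l
    have h3 : ∀ i : Fin 3, i = 0 ∨ i = 1 ∨ i = 2 := by decide
    rcases h3 k with rfl | rfl | rfl
    · exact hW0b l
    · exact hW1b l
    · rw [hW2]
      have h := hA i₁ l
      rwa [hw1, one_mul] at h
  -- the block entries of `g`: `|D|·|g i k|² ≤ 1`
  have hvd : Valued.v (u ^ 2 + u * v * T + v ^ 2 * N) * Valued.v (X i₀ 0 * (X i₀ 1 * T - X i₀ 0 * N) - X i₀ 1 * X i₀ 1) = 1 := by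
    rw [hd, Valuation.map_neg, map_inv₀, inv_mul_cancel₀ ((Valuation.ne_zero_iff _).2 hQ0)]
  have hQg : ∀ i, Valued.v (g i 0 * (g i 1 * T - g i 0 * N) - g i 1 * g i 1) ≤ 1 := by
    intro i
    rw [hg0, hg1, Q_rowAct, map_mul]
    calc Valued.v (u ^ 2 + u * v * T + v ^ 2 * N) * Valued.v (X i 0 * (X i 1 * T - X i 0 * N) - X i 1 * X i 1)
        ≤ Valued.v (u ^ 2 + u * v * T + v ^ 2 * N) * Valued.v (X i₀ 0 * (X i₀ 1 * T - X i₀ 0 * N) - X i₀ 1 * X i₀ 1) :=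
          mul_le_mul_right (hi₀ i (Finset.mem_univ _)) _
      _ = 1 := hvd
  have hgb : ∀ i k, Valued.v D * Valued.v (g i k) ^ 2 ≤ 1 := by
    intro i k
    have h3 : ∀ i : Fin 3, i = 0 ∨ i = 1 ∨ i = 2 := by decide
    rcases h3 k with rfl | rfl | rfl
    · rw [← map_pow, ← map_mul]; exact ((v_discr_mul_sq_le_v_normForm hπ hT hN (g i 0) (g i 1)).1).trans (hQg i)
    · rw [← map_pow, ← map_mul]; exact ((v_discr_mul_sq_le_v_normForm hπ hT hN (g i 0) (g i 1)).2).trans (hQg i)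
    · rw [hg2]; exact mul_le_one' hD1 (pow_le_one' (hw i) _)
  -- §3 the estimate
  intro i j k l
  have hq : Valued.v (ϖ ^ L) ≤ Valued.v D * Valued.v pc ^ 2 := by rw [← map_pow, ← map_mul]; exact hD
  have hq1 : Valued.v (ϖ ^ L) ≤ 1 := hD.trans (by rw [map_mul, map_pow]; exact mul_le_one' hD1 (pow_le_one' hpc1 _))
  exact v_mul_mul_le_one_of_sq (hgb i j) (hWb k l) hq hq1

/-- **THEOREM 18 AT THE MIXED TORUS `E^× × F^×` OF `GL₃`, EXPLICIT** (Harish-Chandra's Theorem 18 + Corollary, route (i), no field extension).  Let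
`γ = !![0, −N, 0; 1, T, 0; 0, 0, c]` with `π = X² − TX + N` rootless in `F`, and let `y = x γ x⁻¹` have INTEGRAL entries.  If `|ϖ^L| ≤ |(T² − 4N)·(c² − Tc + N)²|`
(`= |D(γ)|`, the discriminant of the characteristic polynomial of `γ`), then `x · t ∈ 𝔅_L` for some `t` in the centraliser of `γ` (`t = diag(u + vC_π, 1)`):
the conjugating set of the class of `γ` meets `𝔅`-balls only within `𝔅_L · Z(γ)` with `q^{−L} = |D(γ)|` (radius polynomial in `|D(γ)|⁻¹`).
[cite: HarishChandra1970, Part VII §2 Theorem 18 p. 69, Corollary p. 69; §3 Lemma 46, Theorem 19 p. 73] -/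
theorem exists_adBall_mul_centralizer_of_conj_integral_mixed {ϖ : F} (hϖ0 : ϖ ≠ 0) {x γ : GL (Fin 3) F} {T N c : F}
    (hγ : (γ : Matrix (Fin 3) (Fin 3) F) = !![0, -N, 0; 1, T, 0; 0, 0, c]) (hπ : ∀ r : F, r ^ 2 - T * r + N ≠ 0)
    (hy : ∀ i j, Valued.v ((((x * γ * x⁻¹ : GL (Fin 3) F)) : Matrix (Fin 3) (Fin 3) F) i j) ≤ 1) {L : ℕ}
    (hD : Valued.v (ϖ ^ L) ≤ Valued.v ((T ^ 2 - 4 * N) * (c ^ 2 - T * c + N) ^ 2)) :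
    ∃ t : GL (Fin 3) F, t * γ = γ * t ∧
      ∀ i j k l, Valued.v (ϖ ^ L * (((x * t : GL (Fin 3) F) : Matrix (Fin 3) (Fin 3) F) i j * (((x * t)⁻¹ : GL (Fin 3) F) : Matrix (Fin 3) (Fin 3) F) k l)) ≤ 1 := by
  -- normalise the third column of `x` by a scalar: top entry `1`
  obtain ⟨i₂, hi₂⟩ := exists_apply_ne_zero_of_col x 2
  obtain ⟨i₁, -, hi₁⟩ := Finset.exists_max_image (Finset.univ : Finset (Fin 3)) (fun i => Valued.v ((x : Matrix (Fin 3) (Fin 3) F) i 2)) ⟨i₂, Finset.mem_univ _⟩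
  have hw0 : (x : Matrix (Fin 3) (Fin 3) F) i₁ 2 ≠ 0 := by
    intro h0
    have h1 := hi₁ i₂ (Finset.mem_univ _)
    rw [h0, map_zero, le_zero_iff] at h1
    exact hi₂ ((Valuation.zero_iff _).1 h1)
  set μ : Fˣ := (Units.mk0 _ hw0)⁻¹ with hμ
  set x₁ : GL (Fin 3) F := x * Matrix.GeneralLinearGroup.scalar (Fin 3) μ with hx₁
  have hx₁2 : ∀ i, ((x₁ : GL (Fin 3) F) : Matrix (Fin 3) (Fin 3) F) i 2 = (x : Matrix (Fin 3) (Fin 3) F) i 2 * ((x : Matrix (Fin 3) (Fin 3) F) i₁ 2)⁻¹ := fun i => by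
    rw [hx₁, coe_mul_scalar_apply, hμ, Units.val_inv_eq_inv_val, Units.val_mk0]
  have hw1 : ((x₁ : GL (Fin 3) F) : Matrix (Fin 3) (Fin 3) F) i₁ 2 = 1 := by rw [hx₁2, mul_inv_cancel₀ hw0]
  have hw : ∀ i, Valued.v (((x₁ : GL (Fin 3) F) : Matrix (Fin 3) (Fin 3) F) i 2) ≤ 1 := by
    intro i
    rw [hx₁2, map_mul, map_inv₀]
    calc Valued.v ((x : Matrix (Fin 3) (Fin 3) F) i 2) * (Valued.v ((x : Matrix (Fin 3) (Fin 3) F) i₁ 2))⁻¹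
        ≤ Valued.v ((x : Matrix (Fin 3) (Fin 3) F) i₁ 2) * (Valued.v ((x : Matrix (Fin 3) (Fin 3) F) i₁ 2))⁻¹ := mul_le_mul_left (hi₁ i (Finset.mem_univ _)) _
      _ = 1 := mul_inv_cancel₀ ((Valuation.ne_zero_iff _).2 hw0)
  -- `x₁ γ x₁⁻¹ = x γ x⁻¹`
  have hsγ : Matrix.GeneralLinearGroup.scalar (Fin 3) μ * γ * (Matrix.GeneralLinearGroup.scalar (Fin 3) μ)⁻¹ = γ := by
    rw [Matrix.GeneralLinearGroup.scalar_commute, mul_inv_cancel_right]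
  have hconj : x₁ * γ * x₁⁻¹ = x * γ * x⁻¹ := by
    rw [hx₁, _root_.mul_inv_rev]
    calc x * Matrix.GeneralLinearGroup.scalar (Fin 3) μ * γ * ((Matrix.GeneralLinearGroup.scalar (Fin 3) μ)⁻¹ * x⁻¹)
        = x * (Matrix.GeneralLinearGroup.scalar (Fin 3) μ * γ * (Matrix.GeneralLinearGroup.scalar (Fin 3) μ)⁻¹) * x⁻¹ := by simp only [mul_assoc]
      _ = x * γ * x⁻¹ := by rw [hsγ]
  have hy₁ : ∀ i j, Valued.v ((((x₁ * γ * x₁⁻¹ : GL (Fin 3) F)) : Matrix (Fin 3) (Fin 3) F) i j) ≤ 1 := by rw [hconj]; exact hy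
  obtain ⟨t, htγ, hB⟩ := exists_adBall_mul_centralizer_of_conj_integral_mixed_of_col hϖ0 hγ hπ hy₁ hw1 hw hD
  refine ⟨t, htγ, ?_⟩
  -- `x₁ t = (x t) · μ·1`
  have hxt : x₁ * t = x * t * Matrix.GeneralLinearGroup.scalar (Fin 3) μ := by
    rw [hx₁, mul_assoc, Matrix.GeneralLinearGroup.scalar_commute, mul_assoc]
  rw [hxt] at hB
  exact (adBall_mul_scalar_iff ϖ L (x * t) μ).1 hB

/-! ## §3  The road's normalisation: `D♮ = D ∕ det²`, `π y ∈ Ω s`, and the `Irreducible` phrasing of ★ `K2E3GL3MixedCompanionNormalForm`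

(ED. 2, appended; §1–§2 byte-identical.)  BLUEPRINT v4 §2 states T18-mixed as: `y = xγx⁻¹` integral with `ϖ^s y⁻¹` integral (the normalised lift, `π y ∈ Ω s`)
and `q^{−L} ≤ |D♮(γ)|`, `D♮ := disc(charpoly) ∕ det²` (scale-invariant), `⇒ x t ∈ 𝔅_{6s+L}`.  Since `det γ = N c` and `|ϖ^{3s}| ≤ |det y| = |N c|`
(`ϖ^s y⁻¹` integral), `|ϖ^{6s+L}| ≤ |ϖ^L (Nc)²| ≤ |D(γ)|` and §2 applies with `L ↦ 6s + L`.  The companion step ★ `K2E3GL3MixedCompanionNormalForm` phrases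
the side condition as `Irreducible (X² − C T X + C N)`; a root `r` would give degree `1`, so it implies `∀ r, r² − T r + N ≠ 0`. -/

section Normalised

open Polynomial

omit [Valued F ℤᵐ⁰] [ValuativeRel F] [(Valued.v : Valuation F ℤᵐ⁰).Compatible] [IsNonarchimedeanLocalField F] in
/-- An irreducible monic quadratic has no root: `Irreducible (X² − T X + N) ⇒ ∀ r, r² − T r + N ≠ 0` (the phrasing of ★ `K2E3GL3MixedCompanionNormalForm`
versus the one of §2). [folklore] -/
theorem forall_sq_sub_add_ne_zero_of_irreducible {T N : F} (hirr : Irreducible (X ^ 2 - C T * X + C N : F[X])) : ∀ r : F, r ^ 2 - T * r + N ≠ 0 := by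
  intro r hr
  have hroot : (X ^ 2 - C T * X + C N : F[X]).IsRoot r := by
    simp only [Polynomial.IsRoot.def, eval_add, eval_sub, eval_mul, eval_pow, eval_X, eval_C]
    exact hr
  have h1 := Polynomial.natDegree_eq_of_degree_eq_some (Polynomial.degree_eq_one_of_irreducible_of_root hirr hroot)
  have h2 : (X ^ 2 - C T * X + C N : F[X]).natDegree = 2 := by compute_degree!
  rw [h2] at h1
  exact absurd h1 (by norm_num)

omit [Valued F ℤᵐ⁰] [ValuativeRel F] [(Valued.v : Valuation F ℤᵐ⁰).Compatible] [IsNonarchimedeanLocalField F] in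
/-- `det(x γ x⁻¹) = N · c` for the companion form `γ = !![0, −N, 0; 1, T, 0; 0, 0, c]`. [folklore] -/
theorem det_conj_companion_eq {x γ : GL (Fin 3) F} {T N c : F} (hγ : (γ : Matrix (Fin 3) (Fin 3) F) = !![0, -N, 0; 1, T, 0; 0, 0, c]) :
    (((x * γ * x⁻¹ : GL (Fin 3) F)) : Matrix (Fin 3) (Fin 3) F).det = N * c := by
  rw [Units.val_mul, Units.val_mul, Matrix.det_units_conj, hγ, Matrix.det_fin_three]
  simp

omit [ValuativeRel F] [(Valued.v : Valuation F ℤᵐ⁰).Compatible] [IsNonarchimedeanLocalField F] in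
/-- If `ϖ^s y⁻¹` is integral then `|ϖ^s|³ ≤ |det y|` (`det(ϖ^s y⁻¹) = ϖ^{3s} ∕ det y` is integral). [folklore] -/
theorem v_pow_pow_three_le_v_det {ϖ : F} {y : GL (Fin 3) F} {s : ℕ}
    (hs : ∀ i j, Valued.v (ϖ ^ s * (((y⁻¹ : GL (Fin 3) F)) : Matrix (Fin 3) (Fin 3) F) i j) ≤ 1) :
    Valued.v ((ϖ ^ s) ^ 3) ≤ Valued.v ((y : GL (Fin 3) F) : Matrix (Fin 3) (Fin 3) F).det := by
  set Z : Matrix (Fin 3) (Fin 3) F := ϖ ^ s • (((y⁻¹ : GL (Fin 3) F)) : Matrix (Fin 3) (Fin 3) F) with hZ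
  have hZ1 : Valued.v Z.det ≤ 1 := by
    have h := K2E3GL3FinConjBoxes.v_det_le_of_entries_le (M := 0) Z
      (fun i j => by rw [WithZero.exp_zero, hZ, Matrix.smul_apply, smul_eq_mul]; exact hs i j)
    rwa [mul_zero, WithZero.exp_zero] at h
  have hZdet : Z.det * ((y : GL (Fin 3) F) : Matrix (Fin 3) (Fin 3) F).det = (ϖ ^ s) ^ 3 := by
    rw [hZ, Matrix.det_smul, Fintype.card_fin, mul_assoc, ← Matrix.det_mul, ← Units.val_mul, inv_mul_cancel, Units.val_one, Matrix.det_one, mul_one]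
  rw [← hZdet, map_mul]
  exact mul_le_of_le_one_left' hZ1

/-- **THEOREM 18 AT THE MIXED TORUS, IN THE ROAD'S NORMALISATION** (BLUEPRINT v4 §2 «T18-mixed»): `γ = !![0, −N, 0; 1, T, 0; 0, 0, c]` with `X² − TX + N`
rootless, `y = xγx⁻¹` integral with `ϖ^s y⁻¹` integral (`π y ∈ Ω s`), and `|ϖ^L| ≤ |D♮(γ)|` written without division as `|ϖ^L (det γ)²| ≤ |D(γ)|`
(`det γ = N c`, `D(γ) = (T² − 4N)·π(c)²`, `D♮ = D ∕ det²`) ⇒ `x t ∈ 𝔅_{6s+L}` for some `t ∈ Z(γ)`.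
[cite: HarishChandra1970, Part VII §2 Theorem 18 p. 69, Corollary p. 69; §3 Lemma 46, Theorem 19 p. 73] -/
theorem exists_adBall_mul_centralizer_of_conj_integral_mixed_normalised {ϖ : F} (hϖ0 : ϖ ≠ 0) {x γ : GL (Fin 3) F} {T N c : F}
    (hγ : (γ : Matrix (Fin 3) (Fin 3) F) = !![0, -N, 0; 1, T, 0; 0, 0, c]) (hπ : ∀ r : F, r ^ 2 - T * r + N ≠ 0)
    (hy : ∀ i j, Valued.v ((((x * γ * x⁻¹ : GL (Fin 3) F)) : Matrix (Fin 3) (Fin 3) F) i j) ≤ 1) {s : ℕ}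
    (hs : ∀ i j, Valued.v (ϖ ^ s * ((((x * γ * x⁻¹)⁻¹ : GL (Fin 3) F)) : Matrix (Fin 3) (Fin 3) F) i j) ≤ 1) {L : ℕ}
    (hD : Valued.v (ϖ ^ L * (N * c) ^ 2) ≤ Valued.v ((T ^ 2 - 4 * N) * (c ^ 2 - T * c + N) ^ 2)) :
    ∃ t : GL (Fin 3) F, t * γ = γ * t ∧
      ∀ i j k l, Valued.v (ϖ ^ (6 * s + L) * (((x * t : GL (Fin 3) F) : Matrix (Fin 3) (Fin 3) F) i j *
        (((x * t)⁻¹ : GL (Fin 3) F) : Matrix (Fin 3) (Fin 3) F) k l)) ≤ 1 := by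
  have h3s : Valued.v ((ϖ ^ s) ^ 3) ≤ Valued.v (N * c) := by
    rw [← det_conj_companion_eq (x := x) hγ]
    exact v_pow_pow_three_le_v_det hs
  have hD' : Valued.v (ϖ ^ (6 * s + L)) ≤ Valued.v ((T ^ 2 - 4 * N) * (c ^ 2 - T * c + N) ^ 2) := by
    have h6 : ϖ ^ (6 * s + L) = ϖ ^ L * ((ϖ ^ s) ^ 3 * (ϖ ^ s) ^ 3) := by ring
    refine le_trans ?_ hD
    rw [h6, map_mul, map_mul, map_mul Valued.v (ϖ ^ L), map_pow Valued.v (N * c), sq]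
    exact mul_le_mul' le_rfl (mul_le_mul' h3s h3s)
  exact exists_adBall_mul_centralizer_of_conj_integral_mixed hϖ0 hγ hπ hy hD'

/-- The same with the side condition phrased as in ★ `K2E3GL3MixedCompanionNormalForm.normalForm_companion_of_discr_ne_zero` (`Irreducible (X² − C T X + C N)`).
[cite: HarishChandra1970, Part VII §2 Theorem 18 p. 69, Corollary p. 69] -/
theorem exists_adBall_mul_centralizer_of_conj_integral_mixed_of_irreducible {ϖ : F} (hϖ0 : ϖ ≠ 0) {x γ : GL (Fin 3) F} {T N c : F}
    (hγ : (γ : Matrix (Fin 3) (Fin 3) F) = !![0, -N, 0; 1, T, 0; 0, 0, c]) (hirr : Irreducible (X ^ 2 - C T * X + C N : F[X]))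
    (hy : ∀ i j, Valued.v ((((x * γ * x⁻¹ : GL (Fin 3) F)) : Matrix (Fin 3) (Fin 3) F) i j) ≤ 1) {s : ℕ}
    (hs : ∀ i j, Valued.v (ϖ ^ s * ((((x * γ * x⁻¹)⁻¹ : GL (Fin 3) F)) : Matrix (Fin 3) (Fin 3) F) i j) ≤ 1) {L : ℕ}
    (hD : Valued.v (ϖ ^ L * (N * c) ^ 2) ≤ Valued.v ((T ^ 2 - 4 * N) * (c ^ 2 - T * c + N) ^ 2)) :
    ∃ t : GL (Fin 3) F, t * γ = γ * t ∧
      ∀ i j k l, Valued.v (ϖ ^ (6 * s + L) * (((x * t : GL (Fin 3) F) : Matrix (Fin 3) (Fin 3) F) i j *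
        (((x * t)⁻¹ : GL (Fin 3) F) : Matrix (Fin 3) (Fin 3) F) k l)) ≤ 1 :=
  exists_adBall_mul_centralizer_of_conj_integral_mixed_normalised hϖ0 hγ (forall_sq_sub_add_ne_zero_of_irreducible hirr) hy hs hD

end Normalised

end Summit.HodgeConjecture.HodgeConjecture.Cruxes.H413.K2E3GL3TruncatedCharMixedTorusRadius

end
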